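import Mathlib
import Summits.KontsevichZagierPeriods.Zeta5Search.LaiDecaySplit
import Summits.KontsevichZagierPeriods.Zeta5Search.LaiBricks
import HarnessLib

/-!
# ζ(5) search — the summand `C_n R_n(ν)` of Lai's box series in FACTORIALS, and its logarithm
# (fam-indep, κ₃ ladder, gen 5; decay target D1, part 1 of 2)

HONEST FRAMING: systematic search; no irrationality claim unless certified.

OUR work (Summit side; cell `pub-zeta5`, family `indep`, planner seat gen 5, STAGED for the lane). First half of the
UNIFORM STIRLING target (D1) of `LaiDecaySplit` (families/indep/DECAY-L1.md §2, Lemma 2.1): at an integer point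
`ν > rn` every Pochhammer string of `laiCore J r M n δ ν = laiNum / laiDen` (tree `LaiBoxReflection`) and the constant
`laiC` (tree `LaiBricks`) is a ratio of factorials, so `log (C_n R_n(ν))` is a signed sum of `log m!`:

* `laiNum_mul_factorial` — `laiNum(ν) · (ν−1−rn)! · (ν+Mn)! = (2ν+Mn) · (ν−1)! · (ν+Mn+rn)!`;
* `laiBlock_mul_factorial` — `laiBlock M δ n ν · (ν+δn−1)! = (ν+δn+(M−2δ)n)!` (`ν ≥ 1`);
* `laiC_mul_pow_factorial` — `laiC · n!^{2r} = ∏_j ((M−2δ_j)n)!`;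
* positivity (`laiNum_cast_pos`, `laiBlock_cast_pos`, `laiC_cast_pos`, `laiTermR_laiC_pos`) and the two routine
  `LaiDecayInputs` fields `laiTermR_laiC_nonneg` (ν ≥ 1) and `laiTermR_laiC_zero` (1 ≤ ν ≤ rn);
* **`log_laiTermR_laiC`** — for `ν > rn`:
  `log (C_n R_n(ν)) = [Σ_j lf((M−2δ_j)n) − 2r·lf(n)] + log(2ν+Mn) + [lf(ν−1) − lf(ν−1−rn)] + [lf(ν+Mn+rn) − lf(ν+Mn)]
   − Σ_j [lf(ν+δ_jn+(M−2δ_j)n) − lf(ν+δ_jn−1)]`, `lf m = log m!`.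

Part 2 (`LaiDecayUniform`) inserts Stirling with the tree's error term `WellPoisedFaceRate.logFactErr` and proves the
`upper`/`lower` fields. MANUSCRIPT-LEVEL CANDIDATE context only ('κ₃ ≤ 73'): no rate, margin or dimension statement.

References: [Lai2024BallRivoal] L. Lai, arXiv:2407.14236, §3 (3.1), §13; families/indep/DECAY-L1.md §2 Lemma 2.1.
-/

open Finset
open scoped Nat

namespace Summit.KontsevichZagierPeriods.Zeta5Search

noncomputable section

/-! ### Pochhammer strings at integer points are factorial ratios -/

/-- `∏_{i<k} (ν − (i+1)) · (ν−1−k)! = (ν−1)!` for `k ≤ ν − 1` (falling factorial). [folklore] -/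
theorem prod_sub_succ_mul_factorial {ν k : ℕ} (hk : k + 1 ≤ ν) :
    (∏ i ∈ range k, ((ν : ℝ) - ((i : ℝ) + 1))) * ((ν - 1 - k)! : ℝ) = ((ν - 1)! : ℝ) := by
  have h := Nat.factorial_mul_descFactorial (show k ≤ ν - 1 by omega)
  rw [Nat.descFactorial_eq_prod_range] at h
  have h' : (((ν - 1 - k)! : ℕ) : ℝ) * ∏ i ∈ range k, (((ν - 1 - i : ℕ) : ℝ)) = (((ν - 1)! : ℕ) : ℝ) := by
    exact_mod_cast h
  rw [← h', mul_comm]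
  congr 1
  refine prod_congr rfl fun i hi => ?_
  have hi' : i < k := mem_range.1 hi
  rw [Nat.cast_sub (by omega), Nat.cast_sub (by omega)]
  push_cast; ring

/-- `(a)! · ∏_{i<k} (a + (i+1)) = (a+k)!` (rising factorial). [folklore] -/
theorem factorial_mul_prod_add_succ (a k : ℕ) :
    ((a)! : ℝ) * ∏ i ∈ range k, ((a : ℝ) + ((i : ℝ) + 1)) = ((a + k)! : ℝ) := by
  have h := Nat.factorial_mul_ascFactorial a k
  rw [Nat.ascFactorial_eq_prod_range] at h
  have h' : ((a ! : ℕ) : ℝ) * ∏ i ∈ range k, (((a + 1 + i : ℕ) : ℝ)) = (((a + k)! : ℕ) : ℝ) := by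
    exact_mod_cast h
  rw [← h']
  congr 1
  exact prod_congr rfl fun i _ => by push_cast; ring

/-- **Numerator in factorials**: `laiNum(ν)·(ν−1−rn)!·(ν+Mn)! = (2ν+Mn)·(ν−1)!·(ν+Mn+rn)!` for `ν > rn`.
[cite: Lai2024BallRivoal, §13] (our bookkeeping) -/
theorem laiNum_mul_factorial (r M n : ℕ) {ν : ℕ} (hν : r * n < ν) :
    ((laiNum r M n (ν : ℚ) : ℚ) : ℝ) * ((ν - 1 - r * n)! : ℝ) * ((ν + M * n)! : ℝ) =
      (2 * (ν : ℝ) + (M : ℝ) * n) * ((ν - 1)! : ℝ) * ((ν + M * n + r * n)! : ℝ) := by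
  have h1 := prod_sub_succ_mul_factorial (ν := ν) (k := r * n) (by omega)
  have h2 := factorial_mul_prod_add_succ (ν + M * n) (r * n)
  unfold laiNum
  push_cast
  have e2 : ∏ i ∈ range (r * n), ((ν : ℝ) + (M : ℝ) * n + ((i : ℝ) + 1)) =
      ∏ i ∈ range (r * n), (((ν + M * n : ℕ) : ℝ) + ((i : ℝ) + 1)) := prod_congr rfl fun i _ => by push_cast; ring
  rw [e2]
  calc (2 * (ν : ℝ) + (M : ℝ) * n) * (∏ i ∈ range (r * n), ((ν : ℝ) - ((i : ℝ) + 1))) *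
        (∏ i ∈ range (r * n), (((ν + M * n : ℕ) : ℝ) + ((i : ℝ) + 1))) * ((ν - 1 - r * n)! : ℝ) *
        ((ν + M * n)! : ℝ)
      = (2 * (ν : ℝ) + (M : ℝ) * n) * ((∏ i ∈ range (r * n), ((ν : ℝ) - ((i : ℝ) + 1))) * ((ν - 1 - r * n)! : ℝ))
        * ((((ν + M * n)! : ℝ)) * ∏ i ∈ range (r * n), (((ν + M * n : ℕ) : ℝ) + ((i : ℝ) + 1))) := by ring
    _ = (2 * (ν : ℝ) + (M : ℝ) * n) * ((ν - 1)! : ℝ) * ((ν + M * n + r * n)! : ℝ) := by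
        rw [h1, h2]

/-- **One denominator block in factorials**: `laiBlock M δ n ν · (ν+δn−1)! = (ν+δn+(M−2δ)n)!` for `ν ≥ 1`.
[cite: Lai2024BallRivoal, (3.1)] (our bookkeeping) -/
theorem laiBlock_mul_factorial (M δ n : ℕ) {ν : ℕ} (hν : 1 ≤ ν) :
    ((laiBlock M δ n (ν : ℚ) : ℚ) : ℝ) * ((ν + δ * n - 1)! : ℝ) = ((ν + δ * n + (M - 2 * δ) * n)! : ℝ) := by
  have h := Nat.factorial_mul_ascFactorial (ν + δ * n - 1) ((M - 2 * δ) * n + 1)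
  rw [Nat.ascFactorial_eq_prod_range, show ν + δ * n - 1 + 1 = ν + δ * n by omega,
    show ν + δ * n - 1 + ((M - 2 * δ) * n + 1) = ν + δ * n + (M - 2 * δ) * n by omega] at h
  have h' : (((ν + δ * n - 1)! : ℕ) : ℝ) * ∏ i ∈ range ((M - 2 * δ) * n + 1), (((ν + δ * n + i : ℕ) : ℝ)) =
      (((ν + δ * n + (M - 2 * δ) * n)! : ℕ) : ℝ) := by exact_mod_cast h
  rw [← h', mul_comm]
  congr 1
  unfold laiBlock
  push_cast
  exact prod_congr rfl fun i _ => by ring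

/-- **The constant in factorials**: `laiC · n!^{2r} = ∏_j ((M−2δ_j)n)!`. [cite: Lai2024BallRivoal, §13] -/
theorem laiC_mul_pow_factorial (J r M n : ℕ) (δ : Fin J → ℕ) :
    ((laiC J r M n δ : ℚ) : ℝ) * ((n ! : ℝ) ^ (2 * r)) = ∏ j, ((((M - 2 * δ j) * n)! : ℕ) : ℝ) := by
  unfold laiC
  push_cast
  rw [div_mul_cancel₀ _ (pow_ne_zero _ (by positivity))]

/-! ### Positivity, the zeros, non-negativity -/

/-- `laiNum(ν) > 0` for `ν > rn`. [this file] -/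
theorem laiNum_cast_pos (r M n : ℕ) {ν : ℕ} (hν : r * n < ν) : 0 < ((laiNum r M n (ν : ℚ) : ℚ) : ℝ) := by
  have h := laiNum_mul_factorial r M n hν
  have hpos : 0 < (2 * (ν : ℝ) + (M : ℝ) * n) * ((ν - 1)! : ℝ) * ((ν + M * n + r * n)! : ℝ) := by
    have : (0 : ℝ) < ν := by exact_mod_cast (show 0 < ν by omega)
    positivity
  rw [← h] at hpos
  have hf1 : (0 : ℝ) < ((ν - 1 - r * n)! : ℝ) := by positivity
  have hf2 : (0 : ℝ) < ((ν + M * n)! : ℝ) := by positivity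
  by_contra hle
  rw [not_lt] at hle
  have : ((laiNum r M n (ν : ℚ) : ℚ) : ℝ) * ((ν - 1 - r * n)! : ℝ) * ((ν + M * n)! : ℝ) ≤ 0 :=
    mul_nonpos_of_nonpos_of_nonneg (mul_nonpos_of_nonpos_of_nonneg hle hf1.le) hf2.le
  linarith

/-- `laiBlock(ν) > 0` for `ν ≥ 1`. [this file] -/
theorem laiBlock_cast_pos (M δ n : ℕ) {ν : ℕ} (hν : 1 ≤ ν) : 0 < ((laiBlock M δ n (ν : ℚ) : ℚ) : ℝ) := by
  unfold laiBlock
  push_cast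
  exact prod_pos fun i _ => by
    have : (1 : ℝ) ≤ ν := by exact_mod_cast hν
    positivity

/-- `laiDen(ν) > 0` for `ν ≥ 1`. [this file] -/
theorem laiDen_cast_pos (J M n : ℕ) (δ : Fin J → ℕ) {ν : ℕ} (hν : 1 ≤ ν) :
    0 < ((laiDen J M n δ (ν : ℚ) : ℚ) : ℝ) := by
  unfold laiDen
  push_cast
  exact prod_pos fun j _ => laiBlock_cast_pos M (δ j) n hν

/-- `laiC > 0`. [this file] -/
theorem laiC_cast_pos (J r M n : ℕ) (δ : Fin J → ℕ) : 0 < ((laiC J r M n δ : ℚ) : ℝ) := by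
  unfold laiC
  push_cast
  positivity

/-- The numerator VANISHES at `1 ≤ ν ≤ rn` (the factor `ν − ν`). [cite: Lai2024BallRivoal, §13] -/
theorem laiNum_cast_zero (r M n : ℕ) {ν : ℕ} (h1 : 1 ≤ ν) (h2 : ν ≤ r * n) : laiNum r M n (ν : ℚ) = 0 := by
  unfold laiNum
  have hmem : ν - 1 ∈ range (r * n) := mem_range.2 (by omega)
  have hz : ((ν : ℚ) - (((ν - 1 : ℕ) : ℚ) + 1)) = 0 := by
    rw [Nat.cast_sub h1]; push_cast; ring
  rw [prod_eq_zero hmem hz]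
  ring

/-- ROUTINE FIELD `zero` of `LaiDecayInputs … laiC`: the summand vanishes for `1 ≤ ν ≤ rn`. [this file] -/
theorem laiTermR_laiC_zero (J r M n : ℕ) (δ : Fin J → ℕ) {ν : ℕ} (h1 : 1 ≤ ν) (h2 : ν ≤ r * n) :
    laiTermR J r M n δ (fun m => laiC J r M m δ) ν = 0 := by
  simp [laiTermR, laiCore, laiNum_cast_zero r M n h1 h2]

/-- The summand is POSITIVE for `ν > rn`. [this file] -/
theorem laiTermR_laiC_pos (J r M n : ℕ) (δ : Fin J → ℕ) {ν : ℕ} (hν : r * n < ν) :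
    0 < laiTermR J r M n δ (fun m => laiC J r M m δ) ν := by
  unfold laiTermR laiCore
  push_cast
  exact mul_pos (laiC_cast_pos J r M n δ) (div_pos (laiNum_cast_pos r M n hν) (laiDen_cast_pos J M n δ (by omega)))

/-- ROUTINE FIELD `nonneg` of `LaiDecayInputs … laiC`: the summand is `≥ 0` for `ν ≥ 1`. [this file] -/
theorem laiTermR_laiC_nonneg (J r M n : ℕ) (δ : Fin J → ℕ) {ν : ℕ} (h1 : 1 ≤ ν) :
    0 ≤ laiTermR J r M n δ (fun m => laiC J r M m δ) ν := by
  rcases le_or_gt ν (r * n) with h | h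
  · exact (laiTermR_laiC_zero J r M n δ h1 h).symm.le
  · exact (laiTermR_laiC_pos J r M n δ h).le

/-! ### The logarithm of the summand as a signed sum of `log m!` -/

/-- `log laiNum(ν) = log(2ν+Mn) + [lf(ν−1) − lf(ν−1−rn)] + [lf(ν+Mn+rn) − lf(ν+Mn)]` for `ν > rn`. [this file] -/
theorem log_laiNum (r M n : ℕ) {ν : ℕ} (hν : r * n < ν) :
    Real.log ((laiNum r M n (ν : ℚ) : ℚ) : ℝ) =
      Real.log (2 * (ν : ℝ) + (M : ℝ) * n) + (Real.log ((ν - 1)! : ℝ) - Real.log ((ν - 1 - r * n)! : ℝ)) +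
        (Real.log ((ν + M * n + r * n)! : ℝ) - Real.log ((ν + M * n)! : ℝ)) := by
  have h := laiNum_mul_factorial r M n hν
  have hN := laiNum_cast_pos r M n hν
  have hν0 : (0 : ℝ) < ν := by exact_mod_cast (show 0 < ν by omega)
  have hlog := congrArg Real.log h
  rw [Real.log_mul (mul_pos hN (by positivity)).ne' (by positivity), Real.log_mul hN.ne' (by positivity),
    Real.log_mul (by positivity) (by positivity), Real.log_mul (by positivity) (by positivity)] at hlog
  linarith

/-- `log laiBlock(ν) = lf(ν+δn+(M−2δ)n) − lf(ν+δn−1)` for `ν ≥ 1`. [this file] -/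
theorem log_laiBlock (M δ n : ℕ) {ν : ℕ} (hν : 1 ≤ ν) :
    Real.log ((laiBlock M δ n (ν : ℚ) : ℚ) : ℝ) =
      Real.log ((ν + δ * n + (M - 2 * δ) * n)! : ℝ) - Real.log ((ν + δ * n - 1)! : ℝ) := by
  have h := congrArg Real.log (laiBlock_mul_factorial M δ n hν)
  rw [Real.log_mul (laiBlock_cast_pos M δ n hν).ne' (by positivity)] at h
  linarith

/-- `log laiC = Σ_j lf((M−2δ_j)n) − 2r·lf(n)`. [this file] -/
theorem log_laiC (J r M n : ℕ) (δ : Fin J → ℕ) :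
    Real.log ((laiC J r M n δ : ℚ) : ℝ) =
      (∑ j, Real.log ((((M - 2 * δ j) * n)! : ℕ) : ℝ)) - 2 * r * Real.log ((n ! : ℕ) : ℝ) := by
  have h := congrArg Real.log (laiC_mul_pow_factorial J r M n δ)
  rw [Real.log_mul (laiC_cast_pos J r M n δ).ne' (by positivity), Real.log_pow,
    Real.log_prod (fun j _ => by positivity)] at h
  push_cast at h ⊢
  linarith

/-- **`log (C_n R_n(ν))` as a signed sum of `log m!`** (`ν > rn`). [this file] -/
theorem log_laiTermR_laiC (J r M n : ℕ) (δ : Fin J → ℕ) {ν : ℕ} (hν : r * n < ν) :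
    Real.log (laiTermR J r M n δ (fun m => laiC J r M m δ) ν) =
      ((∑ j, Real.log ((((M - 2 * δ j) * n)! : ℕ) : ℝ)) - 2 * r * Real.log ((n ! : ℕ) : ℝ)) +
      (Real.log (2 * (ν : ℝ) + (M : ℝ) * n) + (Real.log ((ν - 1)! : ℝ) - Real.log ((ν - 1 - r * n)! : ℝ)) +
        (Real.log ((ν + M * n + r * n)! : ℝ) - Real.log ((ν + M * n)! : ℝ))) -
      ∑ j, (Real.log ((ν + δ j * n + (M - 2 * δ j) * n)! : ℝ) - Real.log ((ν + δ j * n - 1)! : ℝ)) := by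
  have h1 : 1 ≤ ν := by omega
  unfold laiTermR laiCore
  push_cast
  rw [Real.log_mul (laiC_cast_pos J r M n δ).ne' (div_pos (laiNum_cast_pos r M n hν)
      (laiDen_cast_pos J M n δ h1)).ne', Real.log_div (laiNum_cast_pos r M n hν).ne' (laiDen_cast_pos J M n δ h1).ne',
    log_laiC, log_laiNum r M n hν]
  have hD : Real.log ((laiDen J M n δ (ν : ℚ) : ℚ) : ℝ) =
      ∑ j, (Real.log ((ν + δ j * n + (M - 2 * δ j) * n)! : ℝ) - Real.log ((ν + δ j * n - 1)! : ℝ)) := by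
    unfold laiDen; push_cast
    rw [Real.log_prod (fun j _ => (laiBlock_cast_pos M (δ j) n h1).ne')]
    exact sum_congr rfl fun j _ => log_laiBlock M (δ j) n h1
  rw [hD]; ring

end

end Summit.KontsevichZagierPeriods.Zeta5Search
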